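import Mathlib
import HarnessLib
import Literature.Probability.MarkovChains.TotalVariation

/-!
# The Bretagnolle–Huber inequality `TV(P,Q) ≤ √(1 − e^{−D(P‖Q)})` through the Bhattacharyya coefficient (finite laws)

For laws on a finite set written as functions (`P ≥ 0`, `Q > 0`, total mass `1`; natural logarithm;
`TV = tvDist = ½Σ|P − Q|` of `MarkovChains/TotalVariation.lean`; `D(P‖Q) = Σ_x P(x) log(P(x)/Q(x))`,
the finite sum of `PinskerInequality.lean` / `KLChiSquareBound.lean`):

* `bhattacharyyaCoeff P Q = B(P,Q) = Σ_x √(P(x)Q(x))`, "the Bhattacharyya coefficient (or Hellinger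
  affinity)", `H²(P,Q) = 2 − 2B(P,Q)` [cite: PolyanskiyWu2024, §7.1 eq. (7.5)];
* `tvDist_eq_one_sub_sum_min` — **(7.3)** `TV(P,Q) = 1 − Σ_x min(P(x),Q(x))` ("`= 1 − ∫ d(P∧Q)`"),
  and `tvDist_eq_sum_max_sub_one` (`TV = Σ_x max(P(x),Q(x)) − 1`) [cite: PolyanskiyWu2024, §7.1
  eq. (7.3)];
* `sq_bhattacharyyaCoeff_add_sq_tvDist_le_one` — **the right half of (7.22)** `TV ≤ H√(1 − H²/4)`, i.e.
  `B² + TV² ≤ 1` (Cauchy–Schwarz: `B = Σ√min·√max ≤ √(Σmin·Σmax) = √((1 − TV)(1 + TV))`)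
  [cite: PolyanskiyWu2024, §7.3 eq. (7.22)] [cite: Canonne2022, §2 (proof of Lemma 2 "from the
  argument of [Tsybakov09], Lemma 2.6", first display)];
* `exp_neg_kl_le_sq_bhattacharyyaCoeff` — **(7.33)** "KL versus Hellinger:
  `D(P‖Q) ≥ 2 log(2/(2 − H²(P,Q)))`", i.e. `e^{−D(P‖Q)} ≤ B(P,Q)²` (Jensen for `log` under `P` on the
  support of `P`) [cite: PolyanskiyWu2024, §7.7 eq. (7.33)] [cite: Canonne2022, §2 (second display)];
* **THE BRETAGNOLLE–HUBER BOUND** `tvDist_sq_add_exp_neg_kl_le_one` (`TV² + e^{−D} ≤ 1`) and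
  `BretagnolleHuber` (`TV(P,Q) ≤ √(1 − e^{−D(P‖Q)})`): "For every `p, q` on `𝒳`,
  `d_TV(p,q) ≤ √(1 − e^{−D(p‖q)})`" [cite: Canonne2022, §2 Lemma 2 ("The BH Bound")], originally
  [cite: BretagnolleHuber1978] (Bretagnolle–Huber, *Estimation des densités: risque minimax*, LNM 649);
* **TSYBAKOV'S VERSION** `tvDist_le_one_sub_half_exp_neg_kl` (`TV ≤ 1 − ½e^{−D}`) and
  `half_exp_neg_kl_le_sum_min` (`½e^{−D(P‖Q)} ≤ Σ_x min(P(x),Q(x))`) [cite: Canonne2022, §2 Corollary 1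
  ("Tsybakov's version", from Lemma 2 and `√(1 − e^{−x}) ≤ 1 − ½e^{−x}`)] (Tsybakov, *Introduction to
  nonparametric estimation* (2009), Lemma 2.6).
Unlike Pinsker's inequality `TV ≤ √(D/2)` (`PinskerInequality.lean`) these bounds never exceed `1` and
keep content for large `D` ("never vacuous, … at worst a `√2` factor off from Pinsker's bound"
[cite: Canonne2022, §2]).  Everything is PROVED (finite sums; 0 named facts).  (The venture file
`Summits/Ventures/LatticeQCDFlow/Scaling/Bhattacharyya.lean` introduced the same coefficient as a
folklore helper `bhatt` with Le Cam's `BC² ≤ 1 − TV²` for its acceptance-versus-volume law; this is the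
cited Literature statement, which that side may import — Literature files cannot import `Summits`.)

Context (cell pub-lqcd, venture LatticeQCDFlow): lower bounds on how distinguishable two sampler
outputs (or a sampler's law and its target) are — `TV ≥ …` needs `D` large, and conversely a moderate
KL certificate caps TV strictly below `1` via `1 − ½e^{−D}`, the regime where Pinsker says nothing.
-/

namespace Literature.Probability.Entropy

open Finset Real
open Literature.Probability.MarkovChains

variable {X : Type*} [Fintype X]

/-- The **Bhattacharyya coefficient** (Hellinger affinity) `B(P,Q) = Σ_x √(P(x)Q(x))`, so that the squared
Hellinger distance is `H²(P,Q) = 2 − 2B(P,Q)`. [cite: PolyanskiyWu2024, §7.1 eq. (7.5) ("the quantity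
`B(P,Q) ≜ ∫√(dPdQ)` is known as the Bhattacharyya coefficient (or Hellinger affinity)")] -/
noncomputable def bhattacharyyaCoeff (P Q : X → ℝ) : ℝ := ∑ x, Real.sqrt (P x * Q x)

/-- `B(P,Q) ≥ 0`. [cite: PolyanskiyWu2024, §7.1 eq. (7.5)] -/
theorem bhattacharyyaCoeff_nonneg (P Q : X → ℝ) : 0 ≤ bhattacharyyaCoeff P Q :=
  sum_nonneg fun _ _ => Real.sqrt_nonneg _

/-- `B(P,Q) = B(Q,P)`. [cite: PolyanskiyWu2024, §7.1 eq. (7.5)] -/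
theorem bhattacharyyaCoeff_comm (P Q : X → ℝ) : bhattacharyyaCoeff P Q = bhattacharyyaCoeff Q P := by
  unfold bhattacharyyaCoeff
  exact sum_congr rfl fun x _ => by rw [mul_comm]

/-- **(7.3)**: `TV(P,Q) = 1 − Σ_x min(P(x),Q(x))` for two laws of mass one ("`TV = ½∫|dP − dQ| =
1 − ∫ d(P∧Q)`"; Canonne: "this is a useful trick, check it!"). [cite: PolyanskiyWu2024, §7.1 eq. (7.3)]
[cite: Canonne2022, §2 (proof of Lemma 2 after [Tsybakov09], first display)] -/
theorem tvDist_eq_one_sub_sum_min {P Q : X → ℝ} (hP1 : ∑ x, P x = 1) (hQ1 : ∑ x, Q x = 1) :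
    tvDist P Q = 1 - ∑ x, min (P x) (Q x) := by
  unfold tvDist
  have e : ∀ x, |P x - Q x| = P x + Q x - 2 * min (P x) (Q x) := fun x => by
    rcases le_total (P x) (Q x) with h | h
    · rw [min_eq_left h, abs_of_nonpos (by linarith)]; ring
    · rw [min_eq_right h, abs_of_nonneg (by linarith)]; ring
  simp_rw [e, sum_sub_distrib, sum_add_distrib, ← mul_sum, hP1, hQ1]
  ring

/-- `TV(P,Q) = Σ_x max(P(x),Q(x)) − 1` for two laws of mass one ("`d_TV = Σ_x max(p(x),q(x)) − 1`").
[cite: Canonne2022, §2 (proof of Lemma 2 after [Tsybakov09], first display)] -/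
theorem tvDist_eq_sum_max_sub_one {P Q : X → ℝ} (hP1 : ∑ x, P x = 1) (hQ1 : ∑ x, Q x = 1) :
    tvDist P Q = ∑ x, max (P x) (Q x) - 1 := by
  rw [tvDist_eq_one_sub_sum_min hP1 hQ1]
  have e : ∀ x, max (P x) (Q x) = P x + Q x - min (P x) (Q x) := fun x => by
    rw [← min_add_max (P x) (Q x)]; ring
  simp_rw [e, sum_sub_distrib, sum_add_distrib, hP1, hQ1]
  ring

/-- **(7.22), right half: `TV ≤ H√(1 − H²/4)`**, equivalently `B(P,Q)² + TV(P,Q)² ≤ 1` (with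
`H² = 2 − 2B`): by Cauchy–Schwarz, `B = Σ_x √(min(P,Q))·√(max(P,Q)) ≤ √(Σ min · Σ max) =
√((1 − TV)(1 + TV))` (Canonne: "`1 − d_TV² = (Σ min)(Σ max) ≥ (Σ√(min·max))² = (Σ√(pq))²`").
[cite: PolyanskiyWu2024, §7.3 eq. (7.22)] [cite: Canonne2022, §2 (proof of Lemma 2 after [Tsybakov09])] -/
theorem sq_bhattacharyyaCoeff_add_sq_tvDist_le_one {P Q : X → ℝ} (hP0 : ∀ x, 0 ≤ P x)
    (hQ0 : ∀ x, 0 ≤ Q x) (hP1 : ∑ x, P x = 1) (hQ1 : ∑ x, Q x = 1) :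
    bhattacharyyaCoeff P Q ^ 2 + tvDist P Q ^ 2 ≤ 1 := by
  have hmin : ∀ x, 0 ≤ min (P x) (Q x) := fun x => le_min (hP0 x) (hQ0 x)
  have hmax : ∀ x, 0 ≤ max (P x) (Q x) := fun x => (hP0 x).trans (le_max_left _ _)
  have hB : bhattacharyyaCoeff P Q
      = ∑ x, Real.sqrt (min (P x) (Q x)) * Real.sqrt (max (P x) (Q x)) := by
    unfold bhattacharyyaCoeff
    exact sum_congr rfl fun x _ => by rw [← Real.sqrt_mul (hmin x), min_mul_max]
  have hcs := sum_mul_sq_le_sq_mul_sq (univ : Finset X) (fun x => Real.sqrt (min (P x) (Q x)))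
    (fun x => Real.sqrt (max (P x) (Q x)))
  simp_rw [Real.sq_sqrt (hmin _), Real.sq_sqrt (hmax _)] at hcs
  have hmin_eq : ∑ x, min (P x) (Q x) = 1 - tvDist P Q := by
    have := tvDist_eq_one_sub_sum_min hP1 hQ1; linarith
  have hmax_eq : ∑ x, max (P x) (Q x) = 1 + tvDist P Q := by
    have := tvDist_eq_sum_max_sub_one hP1 hQ1; linarith
  rw [← hB, hmax_eq, hmin_eq] at hcs
  nlinarith [hcs]

/-- **(7.33), "KL versus Hellinger": `D(P‖Q) ≥ 2 log(2/(2 − H²(P,Q)))`**, i.e. `e^{−D(P‖Q)} ≤ B(P,Q)²`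
(`2 − H² = 2B`).  Proof as printed in Canonne's note: on the support of `P`, Jensen for the concave `log`
gives `log Σ_x P√(Q/P) ≥ Σ_x P log√(Q/P) = −½D(P‖Q)`, and `Σ_x P√(Q/P) = Σ_x √(PQ) ≤ B`.
[cite: PolyanskiyWu2024, §7.7 eq. (7.33)] [cite: Canonne2022, §2 (proof of Lemma 2 after
[Tsybakov09], second display)] -/
theorem exp_neg_kl_le_sq_bhattacharyyaCoeff [DecidableEq X] {P Q : X → ℝ} (hP0 : ∀ x, 0 ≤ P x)
    (hP1 : ∑ x, P x = 1) (hQ : ∀ x, 0 < Q x) :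
    Real.exp (-∑ x, P x * Real.log (P x / Q x)) ≤ bhattacharyyaCoeff P Q ^ 2 := by
  -- restrict to the support `S = {P ≠ 0}`
  set S := univ.filter fun x => P x ≠ 0 with hS
  have hPS : ∀ x ∈ S, 0 < P x := fun x hx => lt_of_le_of_ne (hP0 x) (Ne.symm (mem_filter.1 hx).2)
  have hsumS : ∑ x ∈ S, P x = 1 := by rw [← hP1, hS, sum_filter_ne_zero]
  have hne : S.Nonempty := by
    by_contra h
    rw [not_nonempty_iff_eq_empty] at h
    rw [h, sum_empty] at hsumS
    exact zero_ne_one hsumS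
  have hD : ∑ x, P x * Real.log (P x / Q x) = ∑ x ∈ S, P x * Real.log (P x / Q x) := by
    rw [hS, sum_filter]
    exact sum_congr rfl fun x _ => by by_cases h : P x = 0 <;> simp [h]
  -- Jensen: `Σ_S P log √(Q/P) ≤ log Σ_S P √(Q/P)`
  have hJ : ∑ x ∈ S, P x • Real.log (Real.sqrt (Q x / P x))
      ≤ Real.log (∑ x ∈ S, P x • Real.sqrt (Q x / P x)) :=
    (strictConcaveOn_log_Ioi.concaveOn).le_map_sum (fun x hx => (hPS x hx).le) hsumS
      fun x hx => Set.mem_Ioi.2 (Real.sqrt_pos.2 (div_pos (hQ x) (hPS x hx)))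
  simp only [smul_eq_mul] at hJ
  -- the left side is `−D/2`
  have hL : ∑ x ∈ S, P x * Real.log (Real.sqrt (Q x / P x))
      = -(1 / 2) * ∑ x ∈ S, P x * Real.log (P x / Q x) := by
    rw [Finset.mul_sum]
    refine sum_congr rfl fun x hx => ?_
    have hp := hPS x hx
    rw [Real.log_sqrt (div_pos (hQ x) hp).le, Real.log_div (hQ x).ne' hp.ne',
      Real.log_div hp.ne' (hQ x).ne']
    ring
  -- the right side is `Σ_S √(PQ) ≤ B`
  have hR : ∑ x ∈ S, P x * Real.sqrt (Q x / P x) = ∑ x ∈ S, Real.sqrt (P x * Q x) := by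
    refine sum_congr rfl fun x hx => ?_
    have hp := hPS x hx
    rw [Real.sqrt_div' _ hp.le, Real.sqrt_mul hp.le, mul_div_assoc', mul_comm (P x), mul_div_assoc,
      Real.div_sqrt, mul_comm]
  have hRle : ∑ x ∈ S, Real.sqrt (P x * Q x) ≤ bhattacharyyaCoeff P Q :=
    sum_le_sum_of_subset_of_nonneg (filter_subset _ _) fun x _ _ => Real.sqrt_nonneg _
  have hRpos : 0 < ∑ x ∈ S, P x * Real.sqrt (Q x / P x) :=
    sum_pos (fun x hx => mul_pos (hPS x hx) (Real.sqrt_pos.2 (div_pos (hQ x) (hPS x hx)))) hne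
  have hBpos : 0 < bhattacharyyaCoeff P Q := by rw [hR] at hRpos; exact lt_of_lt_of_le hRpos hRle
  -- assemble: `e^{−D/2} ≤ B`, then square
  have hhalf : Real.exp (-(1 / 2) * ∑ x, P x * Real.log (P x / Q x)) ≤ bhattacharyyaCoeff P Q := by
    rw [hD, ← hL]
    calc Real.exp (∑ x ∈ S, P x * Real.log (Real.sqrt (Q x / P x)))
        ≤ Real.exp (Real.log (∑ x ∈ S, P x * Real.sqrt (Q x / P x))) := Real.exp_le_exp.2 hJ
      _ = ∑ x ∈ S, P x * Real.sqrt (Q x / P x) := Real.exp_log hRpos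
      _ ≤ bhattacharyyaCoeff P Q := by rw [hR]; exact hRle
  have hsq : Real.exp (-∑ x, P x * Real.log (P x / Q x))
      = Real.exp (-(1 / 2) * ∑ x, P x * Real.log (P x / Q x)) ^ 2 := by
    rw [sq, ← Real.exp_add]; ring_nf
  rw [hsq]
  exact pow_le_pow_left₀ (Real.exp_pos _).le hhalf 2

/-- **The Bretagnolle–Huber bound, squared form**: `TV(P,Q)² + e^{−D(P‖Q)} ≤ 1` ("which hold for
arbitrary probability distributions"; here `P ≥ 0`, `Q > 0` on a finite set). [cite: Canonne2022, §2
Lemma 2 ("The BH Bound")] [cite: BretagnolleHuber1978] -/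
theorem tvDist_sq_add_exp_neg_kl_le_one [DecidableEq X] {P Q : X → ℝ} (hP0 : ∀ x, 0 ≤ P x)
    (hP1 : ∑ x, P x = 1) (hQ : ∀ x, 0 < Q x) (hQ1 : ∑ x, Q x = 1) :
    tvDist P Q ^ 2 + Real.exp (-∑ x, P x * Real.log (P x / Q x)) ≤ 1 := by
  have h1 := sq_bhattacharyyaCoeff_add_sq_tvDist_le_one hP0 (fun x => (hQ x).le) hP1 hQ1
  have h2 := exp_neg_kl_le_sq_bhattacharyyaCoeff hP0 hP1 hQ
  linarith

/-- **THE BRETAGNOLLE–HUBER INEQUALITY**: "For every `p, q` on `𝒳`, `d_TV(p,q) ≤ √(1 − e^{−D(p‖q)})`"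
(finite `𝒳`, `q > 0`; `D` in nats). [cite: Canonne2022, §2 Lemma 2 ("The BH Bound"); §1 Theorem 1]
[cite: BretagnolleHuber1978] [cite: PolyanskiyWu2024, §7.3 eq. (7.22) with §7.7 eq. (7.33)] -/
theorem BretagnolleHuber [DecidableEq X] {P Q : X → ℝ} (hP0 : ∀ x, 0 ≤ P x) (hP1 : ∑ x, P x = 1)
    (hQ : ∀ x, 0 < Q x) (hQ1 : ∑ x, Q x = 1) :
    tvDist P Q ≤ Real.sqrt (1 - Real.exp (-∑ x, P x * Real.log (P x / Q x))) := by
  have h := tvDist_sq_add_exp_neg_kl_le_one hP0 hP1 hQ hQ1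
  have htv : 0 ≤ tvDist P Q := tvDist_nonneg P Q
  calc tvDist P Q = |tvDist P Q| := (abs_of_nonneg htv).symm
    _ ≤ _ := Real.abs_le_sqrt (by linarith)

/-- **Tsybakov's version**: "For every `p, q` on `𝒳`, `d_TV(p,q) ≤ 1 − ½e^{−D(p‖q)}`" — from the BH
bound "upon noting that `√(1 − e^{−x}) ≤ 1 − ½e^{−x}` for all `x ∈ [0,∞)` (just square both sides and
expand the RHS)". [cite: Canonne2022, §2 Corollary 1 ("Tsybakov's version")] -/
theorem tvDist_le_one_sub_half_exp_neg_kl [DecidableEq X] {P Q : X → ℝ} (hP0 : ∀ x, 0 ≤ P x)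
    (hP1 : ∑ x, P x = 1) (hQ : ∀ x, 0 < Q x) (hQ1 : ∑ x, Q x = 1) :
    tvDist P Q ≤ 1 - Real.exp (-∑ x, P x * Real.log (P x / Q x)) / 2 := by
  set u := Real.exp (-∑ x, P x * Real.log (P x / Q x)) with hu
  have h := tvDist_sq_add_exp_neg_kl_le_one hP0 hP1 hQ hQ1
  have htv : 0 ≤ tvDist P Q := tvDist_nonneg P Q
  have hu1 : u ≤ 1 := by
    have := sq_nonneg (tvDist P Q); linarith
  have hc : 0 ≤ 1 - u / 2 := by linarith
  -- `TV² ≤ 1 − u ≤ (1 − u/2)²`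
  have hsq : tvDist P Q ^ 2 ≤ (1 - u / 2) ^ 2 := by nlinarith [sq_nonneg u]
  calc tvDist P Q = Real.sqrt (tvDist P Q ^ 2) := (Real.sqrt_sq htv).symm
    _ ≤ Real.sqrt ((1 - u / 2) ^ 2) := Real.sqrt_le_sqrt hsq
    _ = 1 - u / 2 := Real.sqrt_sq hc

/-- **Tsybakov's version, overlap form**: `½e^{−D(P‖Q)} ≤ Σ_x min(P(x),Q(x))` (`= ∫ min(dP, dQ)`, the
total mass of the overlap `P ∧ Q`; with (7.3) this is `TV ≤ 1 − ½e^{−D}`). [cite: Canonne2022, §2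
Corollary 1 with the first display of the proof after [Tsybakov09] (`d_TV = 1 − Σ_x min(p(x),q(x))`)]
[cite: PolyanskiyWu2024, §7.1 eq. (7.3)] -/
theorem half_exp_neg_kl_le_sum_min [DecidableEq X] {P Q : X → ℝ} (hP0 : ∀ x, 0 ≤ P x)
    (hP1 : ∑ x, P x = 1) (hQ : ∀ x, 0 < Q x) (hQ1 : ∑ x, Q x = 1) :
    Real.exp (-∑ x, P x * Real.log (P x / Q x)) / 2 ≤ ∑ x, min (P x) (Q x) := by
  have h := tvDist_le_one_sub_half_exp_neg_kl hP0 hP1 hQ hQ1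
  rw [tvDist_eq_one_sub_sum_min hP1 hQ1] at h
  linarith

end Literature.Probability.Entropy
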